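import Summits.ABC.Analytic.PolySzpiro
import Summits.ABC.Analytic.GlueDegreeConverse
import Summits.ABC.FunctionField.TransferSheetOesterle
import Summits.ABC.FunctionField.TransferSheetWindow
import Summits.ABC.FunctionField.TransferSheetBMY
import Summits.ABC.FunctionField.TransferSheetSixFifths
import Summits.ABC.Harvest.OpenQuestionsGlue
import HarnessLib
import HarnessLib.Audit

/-!
# ABC — ONE kernel currency for rung A-PS and for «weak abc» across the cells abc-an / abc-ff / abc-harv (proof-only)

Cell `abc-an` (C1), seat `pr-2` (KEY GLUE-CUR; plan line 2026-08-27T18:03:45Z, GLUE LEDGER edge **E24**; abc-ff LEAD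
2026-08-27T18:05:45Z «the two Iff bridges are yours»). PROOF-ONLY: no definition, no `sorry`, no named-fact hypothesis;
every statement is an implication/equivalence between ALREADY TYPED sentences, cited BY NAME. HONESTY: abc is not proved
by any of this. Rung **A-PS** (`Summit.ABC.PolySzpiroRat`, polynomial Szpiro over `ℚ`, LADDER-ABC §1, HUMAN D-0139/D-0140)
is **NOT abc — «NOT abc — POLY-SZPIRO(E)»**; POLY-ABC(`M`) / «abc with some exponent» is NOT abc either. Typed ≠ proved.

The three ABC cells typed the same two open sentences in different clothes:
* rung A-PS: `Summit.ABC.PolySzpiroRatEff K C` / `Summit.ABC.PolySzpiroRat` (abc-an, `PolySzpiro.lean`) and the abc-ff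
  transfer sheet's `Summit.ABC.FunctionField.PolySzpiroWith K` (`TransferSheet.lean`);
* weak abc: abc-ff's `Summit.ABC.FunctionField.PolyAbcWith M`, the solo file's `Summit.ABC.ABC.Theorems.PolyABC K`,
  [GenEll]'s `GenEll.ABCWithExponent Λ` (abc-an E20/E21♭), abc-harv's `Summit.ABC.Harvest.PastenWeakABC` (Pasten Conj. 1.2),
  and Lagarias–Soundararajan's `ABCExponentBound κ₁` (abc-an E20′, `GlueDegree.lean`).

## §1 Rung A-PS (E24 (i)/(ii))
E24 (i), pointwise in `K`, is ALREADY abc-ff's `Summit.ABC.FunctionField.polySzpiroWith_iff_exists_polySzpiroRatEff`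
(`TransferSheetLadder.lean`, `Iff.rfl`) — cited, not restated. Here: E24 (ii) `polySzpiroRat_iff_exists_polySzpiroWith :
Summit.ABC.PolySzpiroRat ↔ ∃ K, PolySzpiroWith K` (definitional) and the effective one-liner `polySzpiroWith_of_polySzpiroRatEff`.

## §2 Weak abc (E24 (iii)): the currencies are ONE sentence
`abcWithExponent_of_polyAbcWith : PolyAbcWith M → GenEll.ABCWithExponent M` (`M > 1` by abc-ff's guard
`not_polyAbcWith_of_le_one`; then the two-line `rad ≥ 1` step of abc-an's `abcWithExponent_of_polyABC`, whose module
`GlueDegree.lean` is deliberately NOT imported — it sits in the theses cone of `StewartYuHolds`), and the `∃`-level equivalences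
`exists_polyAbcWith_iff_exists_abcWithExponent` (converse = abc-ff's `polyAbcWith_of_abcWithExponent`, `TransferSheetBMY.lean`) and
`exists_polyAbcWith_iff_pastenWeakABC` (abc-harv's `pastenWeakABC_of_abcWithExponent` / `exists_polyABC_of_pastenWeakABC`,
`OpenQuestionsGlue.lean`). The pointwise `PolyABC M ↔ PolyAbcWith M` is abc-harv's LANDED `Summit.ABC.Harvest.polyABC_iff_polyAbcWith`
(`GlueBaker.lean` §3) and «∃ exponent» ↔ Lagarias–Soundararajan is abc-an's E20′ `exists_abcWithExponent_iff_exists_abcExponentBound`: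
with those two, all five spellings of «abc with some exponent» are interchangeable in the kernel; neither is re-proved here.

## §3 The A-PS SANDWICH in abc-ff's currency, by name
`polyAbcWith_of_polySzpiroWith'` — abc-ff's Oesterlé step `polyAbcWith_of_polySzpiroWith : 0 ≤ K → PolySzpiroWith K →
PolyAbcWith (K/5)` with the sign hypothesis DISCHARGED by abc-ff's own Masser guard `not_polySzpiroWith_of_le_six` (`K > 6`);
`abcWithExponent_of_polySzpiroWith` (`Λ = K/5`); and the partial converse of abc-an's E21♭ read in abc-ff's currency,
`polySzpiroRat_of_polyAbcWith_le : M ≤ 42/41 → PolyAbcWith M → Summit.ABC.PolySzpiroRat` (`K = 7`,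
`polySzpiroRatEff_seven_of_abcLe`). NOT done here, on purpose: the range extension `42/41 → 6/5` (abc-ff referee REF-B's certified
`RefB.polySzpiroWith_of_polyAbcWith'`, `1 < M < 6/5 ⟹ PolySzpiroWith (6M/(6−5M))`, to be landed ONCE by that cell or a named
successor; then «weak abc(`M < 6/5`) ⟹ A-PS» is their theorem ∘ `polySzpiroRat_iff_exists_polySzpiroWith`, zero new analysis).

References: [Oesterle1988] §2–§3; [SilvermanAEC2009] VIII.11.5(b); [MochizukiGenEll2010] Thm 2.1; [PastenShimura2024] Conj. 1.1–1.2;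
[Pasten2021] Conj. 3.2; [LagariasSoundararajan2011] §1; [Masser1990].
-/

noncomputable section

namespace Summit.ABC.Analytic

open Literature.NumberTheory.DiophantineGeometry
open Summit.ABC Summit.ABC.FunctionField

/-! ## §1 Rung A-PS: `Summit.ABC.PolySzpiroRat(Eff)` versus abc-ff's `PolySzpiroWith` -/

/-- **E24 (i), effective direction, by name:** A-PS-eff `(K, C)` is a witness for abc-ff's `PolySzpiroWith K`
(the pointwise `Iff` is abc-ff's `polySzpiroWith_iff_exists_polySzpiroRatEff`). «NOT abc — POLY-SZPIRO(K)». [folklore] -/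
theorem polySzpiroWith_of_polySzpiroRatEff {K C : ℝ} (h : PolySzpiroRatEff K C) : PolySzpiroWith K := ⟨C, h⟩

/-- **E24 (ii) (GLUE LEDGER): rung A-PS IS «abc-ff's `PolySzpiroWith K` for some `K`»** —
`Summit.ABC.PolySzpiroRat ↔ ∃ K, Summit.ABC.FunctionField.PolySzpiroWith K`, definitionally (both sides read
`∃ K C, ∀ E/ℚ, log|Δ_min(E)| ≤ K · log N(E) + C`). One direction is also abc-ff's `polySzpiroRat_of_polySzpiroWith`.
«NOT abc — POLY-SZPIRO(E)». [folklore] -/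
theorem polySzpiroRat_iff_exists_polySzpiroWith : PolySzpiroRat ↔ ∃ K : ℝ, PolySzpiroWith K := Iff.rfl

/-! ## §2 Weak abc: `PolyAbcWith` / `GenEll.ABCWithExponent` / `PastenWeakABC` are one sentence -/

/-- abc-ff's `PolyAbcWith M` forces `1 < M` (contrapositive of abc-ff's window guard `not_polyAbcWith_of_le_one`: the
quality-`> 1` triples of the tree's barrier `EpsilonCannotBeDropped`). [folklore] -/
theorem one_lt_of_polyAbcWith {M : ℝ} (h : PolyAbcWith M) : 1 < M := by
  by_contra hM
  exact not_polyAbcWith_of_le_one (not_lt.mp hM) h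

/-- **E24 (iii): abc-ff's `PolyAbcWith M` ⟹ [GenEll]'s «abc with exponent `M`»** (`GenEll.ABCWithExponent M`:
`∀ ε > 0, ∃ C > 0, c < C · rad^{M(1+ε)}`): `c ≤ C · rad^M ≤ C⁺ · rad^{M(1+ε)} < (C⁺ + 1) · rad^{M(1+ε)}` with `C⁺ = max C 0`,
as `rad ≥ 1` and `M > 0` (`one_lt_of_polyAbcWith`). Same two lines as abc-an's `abcWithExponent_of_polyABC` (`GlueDegree.lean`,
`PolyABC` currency; abc-harv's `polyABC_iff_polyAbcWith` links the two). «NOT abc — POLY-ABC(M)» unless `M = 1`. [folklore] -/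
theorem abcWithExponent_of_polyAbcWith {M : ℝ} (h : PolyAbcWith M) : GenEll.ABCWithExponent M := by
  have hM : 0 < M := lt_trans one_pos (one_lt_of_polyAbcWith h)
  obtain ⟨C, hCM⟩ := h
  intro ε hε
  refine ⟨max C 0 + 1, by positivity, fun a b c habc => ?_⟩
  have hR1 : (1 : ℝ) ≤ ((rad a b c : ℕ) : ℝ) := by exact_mod_cast le_trans one_le_two habc.two_le_rad
  have hpow : ((rad a b c : ℕ) : ℝ) ^ M ≤ ((rad a b c : ℕ) : ℝ) ^ (M * (1 + ε)) :=
    Real.rpow_le_rpow_of_exponent_le hR1 (by nlinarith)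
  have hpos : 0 < ((rad a b c : ℕ) : ℝ) ^ (M * (1 + ε)) := Real.rpow_pos_of_pos (by linarith) _
  calc (c : ℝ) ≤ C * ((rad a b c : ℕ) : ℝ) ^ M := hCM a b c habc
    _ ≤ max C 0 * ((rad a b c : ℕ) : ℝ) ^ M :=
        mul_le_mul_of_nonneg_right (le_max_left _ _) (Real.rpow_nonneg (by linarith) _)
    _ ≤ max C 0 * ((rad a b c : ℕ) : ℝ) ^ (M * (1 + ε)) := mul_le_mul_of_nonneg_left hpow (le_max_right _ _)
    _ < (max C 0 + 1) * ((rad a b c : ℕ) : ℝ) ^ (M * (1 + ε)) := by nlinarith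

/-- **Weak abc, abc-ff ↔ [GenEll] currency (the shape of abc-an's E20):** `(∃ M, PolyAbcWith M) ↔ ∃ Λ > 0, GenEll.ABCWithExponent Λ`.
Forward: `abcWithExponent_of_polyAbcWith` (`Λ = M`); backward: abc-ff's `polyAbcWith_of_abcWithExponent` with `M = Λ + 1`
(`TransferSheetBMY.lean`). With abc-an's E20′ (`exists_abcWithExponent_iff_exists_abcExponentBound`, `GlueDegree.lean`) the
right-hand side is also Lagarias–Soundararajan's `∃ κ₁ > 0, ABCExponentBound κ₁`. [folklore] -/
theorem exists_polyAbcWith_iff_exists_abcWithExponent :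
    (∃ M : ℝ, PolyAbcWith M) ↔ ∃ Λ : ℝ, 0 < Λ ∧ GenEll.ABCWithExponent Λ := by
  constructor
  · rintro ⟨M, hM⟩
    exact ⟨M, lt_trans one_pos (one_lt_of_polyAbcWith hM), abcWithExponent_of_polyAbcWith hM⟩
  · rintro ⟨Λ, hΛ, h⟩
    exact ⟨Λ + 1, polyAbcWith_of_abcWithExponent hΛ h (lt_add_one Λ)⟩

/-- **Weak abc, abc-ff ↔ abc-harv currency:** `(∃ M, PolyAbcWith M) ↔ Summit.ABC.Harvest.PastenWeakABC` (Pasten, JNT 254,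
Conj. 1.2: `∃ κ > 0, abc < rad(abc)^κ`). Forward by abc-harv's `pastenWeakABC_of_abcWithExponent`; backward by abc-harv's
`exists_polyABC_of_pastenWeakABC` (`c ≤ 1 · rad^κ`, a `PolyABC κ`, read as a `PolyAbcWith κ` by forgetting `0 < C` — the
pointwise bridge is abc-harv's `polyABC_iff_polyAbcWith`). [cite: PastenShimura2024, Conj. 1.2 (§1.1, p. 3)] -/
theorem exists_polyAbcWith_iff_pastenWeakABC :
    (∃ M : ℝ, PolyAbcWith M) ↔ Summit.ABC.Harvest.PastenWeakABC := by
  constructor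
  · rintro ⟨M, hM⟩
    exact Summit.ABC.Harvest.pastenWeakABC_of_abcWithExponent ⟨M, abcWithExponent_of_polyAbcWith hM⟩
  · intro h
    obtain ⟨κ, C, -, hC⟩ := Summit.ABC.Harvest.exists_polyABC_of_pastenWeakABC h
    exact ⟨κ, C, hC⟩

/-! ## §3 The A-PS sandwich in abc-ff's currency, by name -/

/-- **A-PS ⟹ weak abc, abc-ff currency, sign hypothesis discharged:** `PolySzpiroWith K → PolyAbcWith (K/5)` for EVERY `K`
— abc-ff's Oesterlé step `polyAbcWith_of_polySzpiroWith` needs `0 ≤ K`, and abc-ff's own Masser guard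
`not_polySzpiroWith_of_le_six` gives `K > 6`. (Oesterlé 1988 §2 Remarque (Szpiro): the `2`-isogenous Frey model,
`N ∣ 2¹² rad`, `c⁵ ≤ 2⁹|Δ_min|`.) «NOT abc — POLY-ABC(K/5)», `K/5 > 6/5`. [cite: Oesterle1988, §2 Remarque (Szpiro), p. 168] -/
theorem polyAbcWith_of_polySzpiroWith' {K : ℝ} (h : PolySzpiroWith K) : PolyAbcWith (K / 5) := by
  have hK : 6 < K := by
    by_contra hK
    exact not_polySzpiroWith_of_le_six (not_lt.mp hK) h
  exact polyAbcWith_of_polySzpiroWith (by linarith) h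

/-- **A-PS-eff `(K, C)` ⟹ abc-ff's `PolyAbcWith (K/5)`**, by name (abc-an's E20 lands on `PolyABC (K/5)` /
`GenEll.ABCWithExponent (K/5)` instead: `polyABC_of_polySzpiroRatEff`, `abcWithExponent_of_polySzpiroRatEff`).
«NOT abc — POLY-ABC(K/5)». [cite: Oesterle1988, §3, p. 169] -/
theorem polyAbcWith_of_polySzpiroRatEff {K C : ℝ} (h : PolySzpiroRatEff K C) : PolyAbcWith (K / 5) :=
  polyAbcWith_of_polySzpiroWith' (polySzpiroWith_of_polySzpiroRatEff h)

/-- **abc-ff's `PolySzpiroWith K` ⟹ «abc with exponent `K/5`»** ([GenEll] currency). [cite: Oesterle1988, §3, p. 169] -/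
theorem abcWithExponent_of_polySzpiroWith {K : ℝ} (h : PolySzpiroWith K) : GenEll.ABCWithExponent (K / 5) :=
  abcWithExponent_of_polyAbcWith (polyAbcWith_of_polySzpiroWith' h)

/-- **E21♭ in abc-ff's currency: `PolyAbcWith M` with `M ≤ 42/41` ⟹ rung A-PS (`K = 7`).** From `c ≤ C · rad^M ≤
max C 0 · rad^{42/41}` (`rad ≥ 1`) and abc-an's `polySzpiroRatEff_seven_of_abcLe` (Silverman AEC VIII.11.5(b) run with
`ε = 1/41` on `c₄³ − c₆² = 1728Δ`, `GlueDegreeConverse.lean`). Vacuous for `M ≤ 1` (`not_polyAbcWith_of_le_one`); the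
window `1 < M ≤ 42/41` is what the kernel certifies today — the printed range is `M < 6/5` (abc-ff REF-B, to be landed by
that cell), and for `M ≥ 6/5` no converse is known. «NOT abc — POLY-SZPIRO(7)». [cite: SilvermanAEC2009, Prop. VIII.11.5(b)] -/
theorem polySzpiroRat_of_polyAbcWith_le {M : ℝ} (hM : M ≤ 42 / 41) (h : PolyAbcWith M) : PolySzpiroRat := by
  obtain ⟨C, hC⟩ := h
  have hK : ∀ a b c : ℕ, IsABCTriple a b c →
      (c : ℝ) ≤ max C 0 * ((rad a b c : ℕ) : ℝ) ^ (42 / 41 : ℝ) := by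
    intro a b c habc
    have hR1 : (1 : ℝ) ≤ ((rad a b c : ℕ) : ℝ) := by exact_mod_cast le_trans one_le_two habc.two_le_rad
    calc (c : ℝ) ≤ C * ((rad a b c : ℕ) : ℝ) ^ M := hC a b c habc
      _ ≤ max C 0 * ((rad a b c : ℕ) : ℝ) ^ M :=
          mul_le_mul_of_nonneg_right (le_max_left _ _) (Real.rpow_nonneg (by linarith) _)
      _ ≤ max C 0 * ((rad a b c : ℕ) : ℝ) ^ (42 / 41 : ℝ) :=
          mul_le_mul_of_nonneg_left (Real.rpow_le_rpow_of_exponent_le hR1 hM) (le_max_right _ _)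
  obtain ⟨C', hC'⟩ := polySzpiroRatEff_seven_of_abcLe hK
  exact ⟨7, C', hC'⟩

/-- **The kernel SANDWICH of rung A-PS, abc-ff currency** (companion of abc-an's `polySzpiroRat_sandwich`):
`ABC ⟹ A-PS`, `A-PS ↔ ∃ K, PolySzpiroWith K`, `PolySzpiroWith K ⟹ PolyAbcWith (K/5)`, `PolyAbcWith M (M ≤ 42/41) ⟹ A-PS`,
and `ABC ↔ ∀ ε > 0, PolyAbcWith (1 + ε)` (abc-ff's `abc_iff_forall_polyAbcWith`). Every node but `ABC` is «NOT abc». [folklore] -/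
theorem polySzpiroWith_sandwich :
    (_root_.ABC → PolySzpiroRat) ∧ (PolySzpiroRat ↔ ∃ K : ℝ, PolySzpiroWith K) ∧
      (∀ K : ℝ, PolySzpiroWith K → PolyAbcWith (K / 5)) ∧
      (∀ M : ℝ, M ≤ 42 / 41 → PolyAbcWith M → PolySzpiroRat) ∧
      (_root_.ABC ↔ ∀ ε : ℝ, 0 < ε → PolyAbcWith (1 + ε)) :=
  ⟨polySzpiroRat_of_abc, polySzpiroRat_iff_exists_polySzpiroWith, fun _ h => polyAbcWith_of_polySzpiroWith' h,
    fun _ hM h => polySzpiroRat_of_polyAbcWith_le hM h, abc_iff_forall_polyAbcWith⟩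

/-! ## §4 E21♯ — the full `6/5` window, by name (appended 2026-08-27 once `TransferSheetSixFifths.lean` landed)

abc-ff referee REF-B's fixed-exponent Oesterlé–Silverman elimination (`TransferSheetSixFifths.lean`, author
refuter-abc-ff-ref-2-g0-0, landed verbatim under the two cells' one-landing rule): `polySzpiroWith_of_polyAbcWith'`
(`1 < M < 6/5 ⟹ PolySzpiroWith (6M/(6−5M))`) and `polySzpiroWith_of_abcWithExponent` (`1 ≤ Λ < 6/5`, every
`E > 6Λ/(6−5Λ)`). Composed with §1's `polySzpiroRat_iff_exists_polySzpiroWith` they SUPERSEDE the kernel range `42/41` of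
abc-an's E21♭ (`polySzpiroRat_of_abcWithExponent_lt`, `GlueDegreeConverse.lean`; its EFFECTIVE fixed-exponent form
`polySzpiroRatEff_of_abcLe_fixedExponent` stays the effective statement of record) and of §3's `polySzpiroRat_of_polyAbcWith_le`.
The window is now the printed one: weak abc with exponent `< 6/5` gives A-PS; A-PS gives back only exponent `K/5 > 6/5`
(§3); between `6/5` and `K/5` nothing is known. Zero new analysis in this section. -/

/-- **E21♯ (GLUE LEDGER), abc-ff currency: `PolyAbcWith M` with `M < 6/5` ⟹ rung A-PS** — `1 < M` is automatic
(`one_lt_of_polyAbcWith`), then abc-ff REF-B's `polySzpiroWith_of_polyAbcWith'` gives `PolySzpiroWith (6M/(6−5M))`, i.e.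
`Summit.ABC.PolySzpiroRat` by `polySzpiroRat_iff_exists_polySzpiroWith`. «NOT abc — POLY-SZPIRO(6M/(6−5M))»; POLY-ABC(M) is
NOT abc. [cite: SilvermanAEC2009, Prop. VIII.11.5(b)] -/
theorem polySzpiroRat_of_polyAbcWith_lt_sixFifths {M : ℝ} (hM : M < 6 / 5) (h : PolyAbcWith M) : PolySzpiroRat :=
  polySzpiroRat_iff_exists_polySzpiroWith.mpr ⟨_, polySzpiroWith_of_polyAbcWith' (one_lt_of_polyAbcWith h) hM h⟩

/-- **E21♯ (GLUE LEDGER), [GenEll] currency: the weak abc conjecture with ANY exponent `Λ < 6/5` implies rung A-PS** —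
`GenEll.ABCWithExponent Λ → Λ < 6/5 → Summit.ABC.PolySzpiroRat`. For `Λ < 1` the hypothesis is void (abc-ff's
`not_abcWithExponent_of_lt_one`); for `1 ≤ Λ < 6/5` abc-ff REF-B's `polySzpiroWith_of_abcWithExponent` gives
`PolySzpiroWith E` with `E = 6Λ/(6−5Λ) + 1`, hence A-PS by `polySzpiroRat_iff_exists_polySzpiroWith`. Supersedes the range
`Λ < 42/41` of `polySzpiroRat_of_abcWithExponent_lt` (E21♭). «NOT abc — POLY-SZPIRO(E)»; «abc with exponent `Λ`» is abc only at
`Λ = 1`. [cite: SilvermanAEC2009, Prop. VIII.11.5(b)] -/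
theorem polySzpiroRat_of_abcWithExponent_lt' {Λ : ℝ} (hΛ : Λ < 6 / 5) (h : GenEll.ABCWithExponent Λ) :
    PolySzpiroRat := by
  rcases lt_or_ge Λ 1 with hΛ1 | hΛ1
  · exact absurd h (Summit.ABC.FunctionField.not_abcWithExponent_of_lt_one hΛ1)
  · exact polySzpiroRat_iff_exists_polySzpiroWith.mpr
      ⟨6 * Λ / (6 - 5 * Λ) + 1, polySzpiroWith_of_abcWithExponent hΛ1 hΛ (lt_add_one _) h⟩

/-- **The two-sided placement of rung A-PS among the «abc with exponent» sentences, final kernel form:**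
`(∃ Λ < 6/5, GenEll.ABCWithExponent Λ) ⟹ Summit.ABC.PolySzpiroRat ⟹ ∃ Λ, GenEll.ABCWithExponent Λ` (the second `Λ` is `K/5 > 6/5`,
§3); neither arrow is known to reverse. A-PS is NOT abc; weak abc is NOT abc. [folklore] -/
theorem polySzpiroRat_between_abcWithExponent :
    ((∃ Λ : ℝ, Λ < 6 / 5 ∧ GenEll.ABCWithExponent Λ) → PolySzpiroRat) ∧
      (PolySzpiroRat → ∃ Λ : ℝ, GenEll.ABCWithExponent Λ) :=
  ⟨fun ⟨_, hΛ, h⟩ => polySzpiroRat_of_abcWithExponent_lt' hΛ h,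
    fun ⟨K, _, hKC⟩ => ⟨K / 5, abcWithExponent_of_polySzpiroWith (polySzpiroWith_of_polySzpiroRatEff hKC)⟩⟩

end Summit.ABC.Analytic

end
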